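import Literature.Topology.FourManifolds.KhTriangleTransfer
import Literature.Topology.FourManifolds.KhKoszulSwap
import HarnessLib

/-!
# The third Reidemeister move: transport of incidence numbers across the move

Sibling file of `KhComplex.lean`, continuing `KhTriangleTransfer.lean`: the tool comparing an
entry of the Khovanov differential of `G` with an entry of the differential of the braid
rearrangement `G' = G.braidMove x y z`.

* `mergeCond_iff_ns`, `splitCond_iff_ns` — for any Gauss diagram, the side condition of an
  incidence number ("the labels agree off the circles through the flipped chord") need only be
  checked on a set of arcs meeting every circle (here: the arcs off the triangle);
* `incidence_transport` — **transport of an incidence number**: for a cube edge `s → t` of `G`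
  and a cube edge `s₂ → t₂` of `G'` whose four states have the same circles off the triangle
  (pairwise `s ~ s₂`, `t ~ t₂`), the same labels off the triangle, and local strands of the
  flipped chords lying on corresponding circles, the two incidence numbers agree up to the ratio
  of their Koszul signs. Khovanov (2000), §5.4; Bar-Natan (2002), §4.4.

No named fact is introduced.

## References

* M. Khovanov, *A categorification of the Jones polynomial*, Duke Math. J. 101 (2000) 359–426,
  §5.4. [cite: Khovanov2000, §5.4]
* D. Bar-Natan, *On Khovanov's categorification of the Jones polynomial*, Algebr. Geom. Topol. 2
  (2002) 337–370, §4.4. [cite: BarNatan2002, §4]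
-/

open Function Finset

noncomputable section

namespace Literature.Topology.FourManifolds

namespace GaussDiagram

/-! ## The side conditions need only be checked on arcs meeting every circle -/

section Cond

variable (K : GaussDiagram) (NS : K.Arc → Prop)

/-- **The side condition of a merge entry reduces to a set of arcs meeting every circle of the
target state.** [folklore] -/
theorem mergeCond_iff_ns {s t : K.EnhancedState} {j : Fin K.n} (hm : K.IsMergeAt s.state j)
    (ht : t.state = Function.update s.state j true)
    (hreach : ∀ c, ∃ e, NS e ∧ (K.stateGraph t.state).Reachable c e) :
    (∀ c, K.circleOf t.state c ≠ K.circleOf t.state (K.arcIn (K.overPos j)) → t.label c = s.label c) ↔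
      (∀ c, NS c → K.circleOf t.state c ≠ K.circleOf t.state (K.arcIn (K.overPos j)) → t.label c = s.label c) := by
  refine ⟨fun h c _ hc ↦ h c hc, fun h c hc ↦ ?_⟩
  obtain ⟨e, he, hce⟩ := hreach c
  have hea : K.circleOf t.state e ≠ K.circleOf t.state (K.arcIn (K.overPos j)) := by
    intro h'; apply hc; rw [← h']; exact circleOf_eq_iff.2 hce
  rw [t.label_eq_of_reachable hce, h e he hea]
  -- `e ~ c` before the merge, as neither lies on the merged circle
  apply s.label_eq_of_reachable
  rw [ht] at hce hc
  have key := (hm.reachable_update_iff e c).1 hce.symm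
  rcases key with k | ⟨-, k⟩ | ⟨-, k⟩
  · exact k
  · exfalso; apply hc
    exact circleOf_eq_iff.2 ((hm.reachable_update_of_reachable k).symm.trans hm.reachable_update.symm)
  · exfalso; apply hc
    exact circleOf_eq_iff.2 (hm.reachable_update_of_reachable k).symm

/-- **The side condition of a split entry reduces to a set of arcs meeting every circle of the
source state.** [folklore] -/
theorem splitCond_iff_ns {s t : K.EnhancedState} {j : Fin K.n} (hsp : K.IsSplitAt s.state j)
    (ht : t.state = Function.update s.state j true)
    (hreach : ∀ c, ∃ e, NS e ∧ (K.stateGraph s.state).Reachable c e) :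
    (∀ c, K.circleOf s.state c ≠ K.circleOf s.state (K.arcIn (K.overPos j)) → t.label c = s.label c) ↔
      (∀ c, NS c → K.circleOf s.state c ≠ K.circleOf s.state (K.arcIn (K.overPos j)) → t.label c = s.label c) := by
  refine ⟨fun h c _ hc ↦ h c hc, fun h c hc ↦ ?_⟩
  obtain ⟨e, he, hce⟩ := hreach c
  have hea : K.circleOf s.state e ≠ K.circleOf s.state (K.arcIn (K.overPos j)) := by
    intro h'; apply hc; rw [← h']; exact circleOf_eq_iff.2 hce
  rw [s.label_eq_of_reachable hce, ← h e he hea]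
  -- `c ~ e` after the split, as `c` is off the split circle
  apply t.label_eq_of_reachable
  rw [ht]
  have key := (hsp.reachable_iff c e).1 hce
  rcases key with k | ⟨k, -⟩ | ⟨k, -⟩
  · exact k
  · exact (hc (circleOf_eq_iff.2 (hsp.reachable_of_reachable_update k))).elim
  · exfalso; apply hc
    exact circleOf_eq_iff.2 ((hsp.reachable_of_reachable_update k).trans hsp.reachable.symm)

end Cond

/-! ## Transport of an incidence number across the move -/

section Transport

variable (G : GaussDiagram) {x y z : Fin G.n}

/-- **Transport of an incidence number across the third move.** Let `s → t` be a cube edge of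
`G` at the chord `j` and `s₂ → t₂` a cube edge of the braid rearrangement at the chord `j₂`,
such that: off the triangle the four states have pairwise the same circles (`s ~ s₂`, `t ~ t₂`)
and the same labels; every arc reaches an arc off the triangle in each of the four states; and
the two local strands of `j` in `G` and of `j₂` in the rearrangement lie, in all four states, on
the circles of two common arcs `a°, b°` off the triangle. Then
`⟨d s₂, t₂⟩ · edgeSign(s, j) = edgeSign(s₂, j₂) · ⟨d s, t⟩`. Khovanov (2000), §5.4; Bar-Natan
(2002), §4.4. [cite: Khovanov2000, §5.4] -/
theorem incidence_transport {R : Type} [CommRing R] (hR tR : R)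
    {s t : G.EnhancedState} {s₂ t₂ : (G.braidMove x y z).EnhancedState} {j j₂ : Fin G.n}
    (hj : s.state j = false) (ht : t.state = Function.update s.state j true)
    (hj₂ : s₂.state j₂ = false) (ht₂ : t₂.state = Function.update s₂.state j₂ true)
    (hRs : ∀ u v, ¬ G.InT x y u → ¬ G.InT x y v →
      ((G.stateGraph s.state).Reachable u v ↔ ((G.braidMove x y z).stateGraph s₂.state).Reachable u v))
    (hRt : ∀ u v, ¬ G.InT x y u → ¬ G.InT x y v →
      ((G.stateGraph t.state).Reachable u v ↔ ((G.braidMove x y z).stateGraph t₂.state).Reachable u v))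
    (hLs : ∀ c, ¬ G.InT x y c → s₂.label c = s.label c)
    (hLt : ∀ c, ¬ G.InT x y c → t₂.label c = t.label c)
    (hEs : ∀ c, ∃ e, ¬ G.InT x y e ∧ (G.stateGraph s.state).Reachable c e)
    (hEt : ∀ c, ∃ e, ¬ G.InT x y e ∧ (G.stateGraph t.state).Reachable c e)
    (hEs₂ : ∀ c, ∃ e, ¬ G.InT x y e ∧ ((G.braidMove x y z).stateGraph s₂.state).Reachable c e)
    (hEt₂ : ∀ c, ∃ e, ¬ G.InT x y e ∧ ((G.braidMove x y z).stateGraph t₂.state).Reachable c e)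
    {a₀ b₀ : G.Arc} (ha₀ : ¬ G.InT x y a₀) (hb₀ : ¬ G.InT x y b₀)
    (has : (G.stateGraph s.state).Reachable (G.arcIn (G.overPos j)) a₀)
    (hat : (G.stateGraph t.state).Reachable (G.arcIn (G.overPos j)) a₀)
    (hbs : (G.stateGraph s.state).Reachable (G.arcOut (G.overPos j)) b₀)
    (hbt : (G.stateGraph t.state).Reachable (G.arcOut (G.overPos j)) b₀)
    (has₂ : ((G.braidMove x y z).stateGraph s₂.state).Reachable ((G.braidMove x y z).arcIn ((G.braidMove x y z).overPos j₂)) a₀)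
    (hat₂ : ((G.braidMove x y z).stateGraph t₂.state).Reachable ((G.braidMove x y z).arcIn ((G.braidMove x y z).overPos j₂)) a₀)
    (hbs₂ : ((G.braidMove x y z).stateGraph s₂.state).Reachable ((G.braidMove x y z).arcOut ((G.braidMove x y z).overPos j₂)) b₀)
    (hbt₂ : ((G.braidMove x y z).stateGraph t₂.state).Reachable ((G.braidMove x y z).arcOut ((G.braidMove x y z).overPos j₂)) b₀) :
    (G.braidMove x y z).incidence R hR tR s₂ t₂ * (edgeSign s.state j : R) =
      (edgeSign s₂.state j₂ : R) * G.incidence R hR tR s t := by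
  -- merge / split correspond
  have hM : G.IsMergeAt s.state j ↔ (G.braidMove x y z).IsMergeAt s₂.state j₂ := by
    unfold IsMergeAt
    rw [and_iff_right hj, and_iff_right hj₂, not_iff_not, circleOf_eq_iff, circleOf_eq_iff]
    constructor
    · intro h
      exact has₂.trans (((hRs a₀ b₀ ha₀ hb₀).1 (has.symm.trans (h.trans hbs))).trans hbs₂.symm)
    · intro h
      exact has.trans (((hRs a₀ b₀ ha₀ hb₀).2 (has₂.symm.trans (h.trans hbs₂))).trans hbs.symm)
  have hS : G.IsSplitAt s.state j ↔ (G.braidMove x y z).IsSplitAt s₂.state j₂ := by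
    unfold IsSplitAt
    rw [and_iff_right hj, and_iff_right hj₂, not_iff_not, ← ht, circleOf_eq_iff, circleOf_eq_iff]
    rw [← ht₂]
    constructor
    · intro h
      exact hat₂.trans (((hRt a₀ b₀ ha₀ hb₀).1 (hat.symm.trans (h.trans hbt))).trans hbt₂.symm)
    · intro h
      exact hat.trans (((hRt a₀ b₀ ha₀ hb₀).2 (hat₂.symm.trans (h.trans hbt₂))).trans hbt.symm)
  -- labels at the local strands
  have la : s₂.label ((G.braidMove x y z).arcIn ((G.braidMove x y z).overPos j₂)) = s.label (G.arcIn (G.overPos j)) := by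
    rw [s₂.label_eq_of_reachable has₂, hLs a₀ ha₀, ← s.label_eq_of_reachable has]
  have lb : s₂.label ((G.braidMove x y z).arcOut ((G.braidMove x y z).overPos j₂)) = s.label (G.arcOut (G.overPos j)) := by
    rw [s₂.label_eq_of_reachable hbs₂, hLs b₀ hb₀, ← s.label_eq_of_reachable hbs]
  have lta : t₂.label ((G.braidMove x y z).arcIn ((G.braidMove x y z).overPos j₂)) = t.label (G.arcIn (G.overPos j)) := by
    rw [t₂.label_eq_of_reachable hat₂, hLt a₀ ha₀, ← t.label_eq_of_reachable hat]
  have ltb : t₂.label ((G.braidMove x y z).arcOut ((G.braidMove x y z).overPos j₂)) = t.label (G.arcOut (G.overPos j)) := by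
    rw [t₂.label_eq_of_reachable hbt₂, hLt b₀ hb₀, ← t.label_eq_of_reachable hbt]
  rw [G.incidence_of_flip R hR tR hj ht, (G.braidMove x y z).incidence_of_flip R hR tR hj₂ ht₂]
  by_cases hm : G.IsMergeAt s.state j
  · have hm₂ := hM.1 hm
    rw [if_pos hm, if_pos hm₂]
    -- the side conditions correspond
    have hC : (∀ c, G.circleOf t.state c ≠ G.circleOf t.state (G.arcIn (G.overPos j)) → t.label c = s.label c) ↔
        (∀ c, (G.braidMove x y z).circleOf t₂.state c ≠ (G.braidMove x y z).circleOf t₂.state ((G.braidMove x y z).arcIn ((G.braidMove x y z).overPos j₂)) → t₂.label c = s₂.label c) := by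
      rw [G.mergeCond_iff_ns (fun c ↦ ¬ G.InT x y c) hm ht hEt, (G.braidMove x y z).mergeCond_iff_ns (fun c ↦ ¬ G.InT x y c) hm₂ ht₂ hEt₂]
      refine forall_congr' fun c ↦ ⟨fun h hc hne ↦ ?_, fun h hc hne ↦ ?_⟩
      · rw [hLt c hc, hLs c hc]
        apply h hc
        intro h'; apply hne
        rw [circleOf_eq_iff] at h' ⊢
        exact ((hRt c a₀ hc ha₀).1 (h'.trans hat)).trans hat₂.symm
      · rw [← hLt c hc, ← hLs c hc]
        apply h hc
        intro h'; apply hne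
        rw [circleOf_eq_iff] at h' ⊢
        exact ((hRt c a₀ hc ha₀).2 (h'.trans hat₂)).trans hat.symm
    by_cases hc : ∀ c, G.circleOf t.state c ≠ G.circleOf t.state (G.arcIn (G.overPos j)) → t.label c = s.label c
    · rw [if_pos hc, if_pos (hC.1 hc), la, lb, lta]; ring
    · rw [if_neg hc, if_neg (fun h ↦ hc (hC.2 h)), mul_zero, zero_mul]
  · have hm₂ : ¬ (G.braidMove x y z).IsMergeAt s₂.state j₂ := fun h ↦ hm (hM.2 h)
    rw [if_neg hm, if_neg hm₂]
    by_cases hsp : G.IsSplitAt s.state j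
    · have hsp₂ := hS.1 hsp
      rw [if_pos hsp, if_pos hsp₂]
      have hC : (∀ c, G.circleOf s.state c ≠ G.circleOf s.state (G.arcIn (G.overPos j)) → t.label c = s.label c) ↔
          (∀ c, (G.braidMove x y z).circleOf s₂.state c ≠ (G.braidMove x y z).circleOf s₂.state ((G.braidMove x y z).arcIn ((G.braidMove x y z).overPos j₂)) → t₂.label c = s₂.label c) := by
        rw [G.splitCond_iff_ns (fun c ↦ ¬ G.InT x y c) hsp ht hEs,
          (G.braidMove x y z).splitCond_iff_ns (fun c ↦ ¬ G.InT x y c) hsp₂ ht₂ hEs₂]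
        refine forall_congr' fun c ↦ ⟨fun h hc hne ↦ ?_, fun h hc hne ↦ ?_⟩
        · rw [hLt c hc, hLs c hc]
          apply h hc
          intro h'; apply hne
          rw [circleOf_eq_iff] at h' ⊢
          exact ((hRs c a₀ hc ha₀).1 (h'.trans has)).trans has₂.symm
        · rw [← hLt c hc, ← hLs c hc]
          apply h hc
          intro h'; apply hne
          rw [circleOf_eq_iff] at h' ⊢
          exact ((hRs c a₀ hc ha₀).2 (h'.trans has₂)).trans has.symm
      by_cases hc : ∀ c, G.circleOf s.state c ≠ G.circleOf s.state (G.arcIn (G.overPos j)) → t.label c = s.label c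
      · rw [if_pos hc, if_pos (hC.1 hc), la, lta, ltb]; ring
      · rw [if_neg hc, if_neg (fun h ↦ hc (hC.2 h)), mul_zero, zero_mul]
    · rw [if_neg hsp, if_neg (fun h ↦ hsp (hS.2 h)), mul_zero, zero_mul]

end Transport


/-! ## Feeding the transport lemma: circles, labels and local strands across the move -/

section Feed

open LocArc

variable (G : GaussDiagram) {x y z : Fin G.n}
variable (hxz : x ≠ z) (ha : (G.overPos y : ℕ) = G.overPos x + 1) (hb : (G.overPos z : ℕ) = G.underPos x + 1)
  (hc : (G.underPos z : ℕ) = G.underPos y + 1) (hx : G.sign x = 1) (hy : G.sign y = 1) (hz : G.sign z = 1)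

include hxz ha hb hc hx hy hz in
/-- Over a rest state of `G` every arc reaches an arc off the triangle. [folklore] -/
theorem exists_notInT_reach_G {σ : G.State} (h : ¬ (σ z = true ∧ (σ x = false → σ y = false))) (c : G.Arc) :
    ∃ e, ¬ G.InT x y e ∧ (G.stateGraph σ).Reachable c e :=
  ⟨_, G.not_inT_retGG' hxz ha hb hc h c, G.reachable_retGG' hxz ha hb hc hx hy hz h c⟩

include hxz ha hb hc hx hy hz in
/-- Over a rest state of the rearrangement every arc reaches an arc off the triangle. [folklore] -/
theorem exists_notInT_reach_G' {σ' : G.State} (h : ¬ (σ' z = true ∧ (σ' x = false → σ' y = false))) (c : G.Arc) :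
    ∃ e, ¬ G.InT x y e ∧ ((G.braidMove x y z).stateGraph σ').Reachable c e :=
  ⟨_, G.not_inT_retG'G hxz ha hb hc h c, G.reachable_retG'G hxz ha hb hc hx hy hz h c⟩

include hxz ha hb hc hx hy hz in
/-- **Off the triangle, the circles of a rest state of `G` and of the corresponding state of the
rearrangement agree.** [cite: Khovanov2000, §5.4] -/
theorem reach_iff_swapSt {σ : G.State} (h : ¬ (σ z = true ∧ (σ x = false → σ y = false))) {u v : G.Arc}
    (hu : ¬ G.InT x y u) (hv : ¬ G.InT x y v) :
    (G.stateGraph σ).Reachable u v ↔ ((G.braidMove x y z).stateGraph (G.swapSt x y z σ)).Reachable u v := by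
  constructor
  · intro huv
    have key := G.reach_rest_G_G' hxz ha hb hc hx hy hz h huv
    rwa [G.retGG'_of_not_inT σ hu, G.retGG'_of_not_inT σ hv] at key
  · intro huv
    have key := G.reach_rest_G'_G hxz ha hb hc hx hy hz h huv
    rwa [G.retG'G_of_not_inT _ hu, G.retG'G_of_not_inT _ hv] at key

include ha hb hc hx hy hz in
/-- Boolean local reachability gives reachability in a state graph of `G`. [folklore] -/
theorem reach_G_of_locReachB (τ : G.State) {a b : LocArc}
    (h : locReachB (locEdgesG (τ x) (τ y) (τ z)) a b = true) :
    (G.stateGraph τ).Reachable (G.locArc x y z a) (G.locArc x y z b) :=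
  G.reachable_of_locGraph_reachable _ (fun _ he ↦ G.reachable_locArc_of_mem ha hb hc hx hy hz τ he)
    (reachable_of_locReachB h)

include hxz ha hb hc hx hy hz in
/-- Boolean local reachability gives reachability in a state graph of the rearrangement. [folklore] -/
theorem reach_G'_of_locReachB (τ : G.State) {a b : LocArc}
    (h : locReachB (locEdgesG' (τ x) (τ y) (τ z)) a b = true) :
    ((G.braidMove x y z).stateGraph τ).Reachable (G.locArc x y z a) (G.locArc x y z b) :=
  G.reachable_of_locGraph_reachable _ (fun _ he ↦ G.reachable_braidMove_locArc_of_mem hxz ha hb hc hx hy hz τ he)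
    (reachable_of_locReachB h)

/-- `swapSt` of a flip in the layer `z = 0` is the flip of the exchanged chord. [folklore] -/
theorem swapSt_update {σ : G.State} (hσ : σ z = false) {j : Fin G.n} (hjz : j ≠ z) :
    G.swapSt x y z (Function.update σ j true) = Function.update (G.swapSt x y z σ) (Equiv.swap x y j) true := by
  have h1 : ¬ σ z = true := by rw [hσ]; exact Bool.false_ne_true
  have h2 : ¬ Function.update σ j true z = true := by rw [Function.update_of_ne hjz.symm, hσ]; exact Bool.false_ne_true
  rw [G.swapSt_of_not_z h2, G.swapSt_of_not_z h1]
  funext i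
  simp only [comp_apply, Function.update_apply, Equiv.apply_eq_iff_eq_symm_apply, Equiv.symm_swap]

end Feed

/-! ## The internal blocks: an edge of `G` inside the rests against the corresponding edge -/

section Internal

open LocArc

variable (G : GaussDiagram) {x y z : Fin G.n}
variable (hxz : x ≠ z) (ha : (G.overPos y : ℕ) = G.overPos x + 1) (hb : (G.overPos z : ℕ) = G.underPos x + 1)
  (hc : (G.underPos z : ℕ) = G.underPos y + 1) (hx : G.sign x = 1) (hy : G.sign y = 1) (hz : G.sign z = 1)

/-- The chord of the rearrangement corresponding to the chord `j` flipped from the rest state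
`σ`: `j` in the layer `z = 1`, the exchanged chord in the layer `z = 0`. [folklore] -/
def jmap (x y z : Fin G.n) (σ : G.State) (j : Fin G.n) : Fin G.n := if σ z = true then j else Equiv.swap x y j

include hxz ha hb hc hx hy hz in
/-- **Transport of an internal entry of the rests.** For rest states `s → t` of `G` (a flip at
`j ≠ z`), the corresponding entry of the rearrangement between `toG' s` and `toG' t` (a flip at
`jmap j`) agrees up to the ratio of Koszul signs. [cite: Khovanov2000, §5.4] -/
theorem incidence_toG' {R : Type} [CommRing R] (hR tR : R) (s t : G.EnhancedState)
    (hs : ¬ (s.state z = true ∧ (s.state x = false → s.state y = false)))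
    (ht' : ¬ (t.state z = true ∧ (t.state x = false → t.state y = false)))
    {j : Fin G.n} (hjz : j ≠ z) (hj : s.state j = false) (ht : t.state = Function.update s.state j true) :
    (G.braidMove x y z).incidence R hR tR (G.toG' hxz ha hb hc hx hy hz s hs) (G.toG' hxz ha hb hc hx hy hz t ht') *
        (edgeSign s.state j : R) =
      (edgeSign (G.swapSt x y z s.state) (G.jmap x y z s.state j) : R) * G.incidence R hR tR s t := by
  -- the flip on the other side
  have hj₂ : (G.toG' hxz ha hb hc hx hy hz s hs).state (G.jmap x y z s.state j) = false := by
    rw [toG'_state]; unfold jmap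
    by_cases hsz : s.state z = true
    · rw [if_pos hsz, G.swapSt_of_z hsz]; exact hj
    · rw [if_neg hsz, G.swapSt_of_not_z hsz]; simp [hj]
  have ht₂ : (G.toG' hxz ha hb hc hx hy hz t ht').state =
      Function.update (G.toG' hxz ha hb hc hx hy hz s hs).state (G.jmap x y z s.state j) true := by
    rw [toG'_state, toG'_state, ht]; unfold jmap
    by_cases hsz : s.state z = true
    · rw [if_pos hsz, G.swapSt_of_z hsz,
        G.swapSt_of_z (σ := Function.update s.state j true) (by rw [Function.update_of_ne hjz.symm]; exact hsz)]
      rfl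
    · rw [if_neg hsz]
      exact G.swapSt_update (Bool.eq_false_iff.mpr hsz) hjz
  -- the common data of the transport lemma
  have hRs := fun u v hu hv ↦ G.reach_iff_swapSt hxz ha hb hc hx hy hz hs (u := u) (v := v) hu hv
  have hRt := fun u v hu hv ↦ G.reach_iff_swapSt hxz ha hb hc hx hy hz ht' (u := u) (v := v) hu hv
  have hLs := fun c hc' ↦ G.toG'_label_of_not_inT hxz ha hb hc hx hy hz s hs (u := c) hc'
  have hLt := fun c hc' ↦ G.toG'_label_of_not_inT hxz ha hb hc hx hy hz t ht' (u := c) hc'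
  have hEs := G.exists_notInT_reach_G hxz ha hb hc hx hy hz hs
  have hEt := G.exists_notInT_reach_G hxz ha hb hc hx hy hz ht'
  have hEs₂ := G.exists_notInT_reach_G' hxz ha hb hc hx hy hz (G.rest_swapSt hxz hc hs)
  have hEt₂ := G.exists_notInT_reach_G' hxz ha hb hc hx hy hz (G.rest_swapSt hxz hc ht')
  by_cases hjx : j = x
  · -- `j = x`, layer `z = 0`: `jmap j = y`, strands `inA` (off the triangle) and `sideA`
    subst hjx
    have hsz : s.state z = false := by
      cases h : s.state z
      · rfl
      · exact (ht' ⟨by rw [ht, Function.update_of_ne hjz.symm, h], fun h' ↦ by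
          rw [ht, Function.update_self] at h'; exact Bool.noConfusion h'⟩).elim
    have hjm : G.jmap j y z s.state j = y := by unfold jmap; rw [hsz]; simp
    rw [hjm] at hj₂ ht₂ ⊢
    have htz : t.state z = false := by rw [ht, Function.update_of_ne hjz.symm, hsz]
    have hsx : s.state j = false := hj
    have htx : t.state j = true := by rw [ht, Function.update_self]
    have hty : t.state y = s.state y := by rw [ht, Function.update_of_ne (G.x_ne_y ha).symm]
    -- the strands: `a = inA` off the triangle, `b = sideA` with representative `outB` or `inC`
    have eov : (G.braidMove j y z).overPos y = G.overPos j := G.overPos_braidMove_y (G.y_ne_z hc)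
    refine G.incidence_transport hR tR hj ht hj₂ ht₂ hRs hRt hLs hLt hEs hEt hEs₂ hEt₂
      (a₀ := G.inA j) (b₀ := if s.state y then G.inC y else G.outB z)
      (G.not_inT_inA hxz ha hb hc)
      (by
        by_cases h : s.state y = true
        · rw [if_pos h]; exact G.not_inT_inC ha hb hc
        · rw [if_neg h]; exact G.not_inT_outB (y := y) hxz)
      (.refl _) (.refl _) ?_ ?_ (by rw [eov]; exact .refl _) (by rw [eov]; exact .refl _) ?_ ?_
    · -- `sideA ~ b₀` in `G` over `s`
      cases hsy : s.state y
      · simp only [Bool.false_eq_true, ↓reduceIte]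
        exact G.reach_G_of_locReachB ha hb hc hx hy hz s.state (a := .sA) (b := .outB) (by rw [hsx, hsy, hsz]; decide)
      · simp only [↓reduceIte]
        exact G.reach_G_of_locReachB ha hb hc hx hy hz s.state (a := .sA) (b := .inC) (by rw [hsx, hsy, hsz]; decide)
    · have hty' := hty
      cases hsy : s.state y
      · simp only [Bool.false_eq_true, ↓reduceIte]
        rw [hsy] at hty'
        exact G.reach_G_of_locReachB ha hb hc hx hy hz t.state (a := .sA) (b := .outB) (by rw [htx, hty', htz]; decide)
      · simp only [↓reduceIte]
        rw [hsy] at hty'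
        exact G.reach_G_of_locReachB ha hb hc hx hy hz t.state (a := .sA) (b := .inC) (by rw [htx, hty', htz]; decide)
    · rw [eov]
      have e1 : (G.toG' hxz ha hb hc hx hy hz s hs).state j = s.state y := by rw [toG'_state, G.swapSt_x hsz]
      have e2 : (G.toG' hxz ha hb hc hx hy hz s hs).state y = false := by rw [toG'_state, G.swapSt_y hsz, hsx]
      have e3 : (G.toG' hxz ha hb hc hx hy hz s hs).state z = false := by rw [toG'_state, G.swapSt_z hxz hc, hsz]
      cases hsy : s.state y
      · simp only [Bool.false_eq_true, ↓reduceIte]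
        rw [hsy] at e1
        exact G.reach_G'_of_locReachB hxz ha hb hc hx hy hz (G.toG' hxz ha hb hc hx hy hz s hs).state
          (a := .sA) (b := .outB) (by rw [e1, e2, e3]; decide)
      · simp only [↓reduceIte]
        rw [hsy] at e1
        exact G.reach_G'_of_locReachB hxz ha hb hc hx hy hz (G.toG' hxz ha hb hc hx hy hz s hs).state
          (a := .sA) (b := .inC) (by rw [e1, e2, e3]; decide)
    · rw [eov]
      have e1 : (G.toG' hxz ha hb hc hx hy hz t ht').state j = s.state y := by rw [toG'_state, G.swapSt_x htz, hty]
      have e2 : (G.toG' hxz ha hb hc hx hy hz t ht').state y = true := by rw [toG'_state, G.swapSt_y htz, htx]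
      have e3 : (G.toG' hxz ha hb hc hx hy hz t ht').state z = false := by rw [toG'_state, G.swapSt_z hxz hc, htz]
      cases hsy : s.state y
      · simp only [Bool.false_eq_true, ↓reduceIte]
        rw [hsy] at e1
        exact G.reach_G'_of_locReachB hxz ha hb hc hx hy hz (G.toG' hxz ha hb hc hx hy hz t ht').state
          (a := .sA) (b := .outB) (by rw [e1, e2, e3]; decide)
      · simp only [↓reduceIte]
        rw [hsy] at e1
        exact G.reach_G'_of_locReachB hxz ha hb hc hx hy hz (G.toG' hxz ha hb hc hx hy hz t ht').state
          (a := .sA) (b := .inC) (by rw [e1, e2, e3]; decide)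
  by_cases hjy : j = y
  · -- `j = y`, layer `z = 0`: `jmap j = x`, strands `sideA` (representative `inB` or `outC`) and `outA`
    subst hjy
    have hsz : s.state z = false := by
      cases h : s.state z
      · rfl
      · exact (hs ⟨h, fun _ ↦ hj⟩).elim
    have hjm : G.jmap x j z s.state j = x := by unfold jmap; rw [hsz]; simp
    rw [hjm] at hj₂ ht₂ ⊢
    have htz : t.state z = false := by rw [ht, Function.update_of_ne hjz.symm, hsz]
    have hsy : s.state j = false := hj
    have hty : t.state j = true := by rw [ht, Function.update_self]
    have htx : t.state x = s.state x := by rw [ht, Function.update_of_ne (G.x_ne_y ha)]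
    have eov : (G.braidMove x j z).overPos x = G.overPos j := G.overPos_braidMove_x hxz
    have eaI : G.arcIn (G.overPos j) = G.sideA x := G.arcIn_overPos_y ha
    refine G.incidence_transport hR tR hj ht hj₂ ht₂ hRs hRt hLs hLt hEs hEt hEs₂ hEt₂
      (a₀ := if s.state x then G.outC z else G.inB x) (b₀ := G.outA j)
      (by
        by_cases h : s.state x = true
        · rw [if_pos h]; exact G.not_inT_outC hxz hc
        · rw [if_neg h]; exact G.not_inT_inB hxz ha hb hc)
      (G.not_inT_outA ha) ?_ ?_ (.refl _) (.refl _) ?_ ?_ (by rw [eov]; exact .refl _) (by rw [eov]; exact .refl _)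
    · rw [eaI]
      cases hsx : s.state x
      · simp only [Bool.false_eq_true, ↓reduceIte]
        exact G.reach_G_of_locReachB ha hb hc hx hy hz s.state (a := .sA) (b := .inB) (by rw [hsx, hsy, hsz]; decide)
      · simp only [↓reduceIte]
        exact G.reach_G_of_locReachB ha hb hc hx hy hz s.state (a := .sA) (b := .outC) (by rw [hsx, hsy, hsz]; decide)
    · rw [eaI]
      have htx' := htx
      cases hsx : s.state x
      · simp only [Bool.false_eq_true, ↓reduceIte]
        rw [hsx] at htx'
        exact G.reach_G_of_locReachB ha hb hc hx hy hz t.state (a := .sA) (b := .inB) (by rw [htx', hty, htz]; decide)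
      · simp only [↓reduceIte]
        rw [hsx] at htx'
        exact G.reach_G_of_locReachB ha hb hc hx hy hz t.state (a := .sA) (b := .outC) (by rw [htx', hty, htz]; decide)
    · rw [eov]
      change ((G.braidMove x j z).stateGraph _).Reachable (G.arcIn (G.overPos j)) _
      rw [eaI]
      have e1 : (G.toG' hxz ha hb hc hx hy hz s hs).state x = false := by rw [toG'_state, G.swapSt_x hsz, hsy]
      have e2 : (G.toG' hxz ha hb hc hx hy hz s hs).state j = s.state x := by rw [toG'_state, G.swapSt_y hsz]
      have e3 : (G.toG' hxz ha hb hc hx hy hz s hs).state z = false := by rw [toG'_state, G.swapSt_z hxz hc, hsz]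
      cases hsx : s.state x
      · simp only [Bool.false_eq_true, ↓reduceIte]
        rw [hsx] at e2
        exact G.reach_G'_of_locReachB hxz ha hb hc hx hy hz (G.toG' hxz ha hb hc hx hy hz s hs).state
          (a := .sA) (b := .inB) (by rw [e1, e2, e3]; decide)
      · simp only [↓reduceIte]
        rw [hsx] at e2
        exact G.reach_G'_of_locReachB hxz ha hb hc hx hy hz (G.toG' hxz ha hb hc hx hy hz s hs).state
          (a := .sA) (b := .outC) (by rw [e1, e2, e3]; decide)
    · rw [eov]
      change ((G.braidMove x j z).stateGraph _).Reachable (G.arcIn (G.overPos j)) _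
      rw [eaI]
      have e1 : (G.toG' hxz ha hb hc hx hy hz t ht').state x = true := by rw [toG'_state, G.swapSt_x htz, hty]
      have e2 : (G.toG' hxz ha hb hc hx hy hz t ht').state j = s.state x := by rw [toG'_state, G.swapSt_y htz, htx]
      have e3 : (G.toG' hxz ha hb hc hx hy hz t ht').state z = false := by rw [toG'_state, G.swapSt_z hxz hc, htz]
      cases hsx : s.state x
      · simp only [Bool.false_eq_true, ↓reduceIte]
        rw [hsx] at e2
        exact G.reach_G'_of_locReachB hxz ha hb hc hx hy hz (G.toG' hxz ha hb hc hx hy hz t ht').state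
          (a := .sA) (b := .inB) (by rw [e1, e2, e3]; decide)
      · simp only [↓reduceIte]
        rw [hsx] at e2
        exact G.reach_G'_of_locReachB hxz ha hb hc hx hy hz (G.toG' hxz ha hb hc hx hy hz t ht').state
          (a := .sA) (b := .outC) (by rw [e1, e2, e3]; decide)
  · -- `j` a fourth chord: same chord, strands off the triangle
    have hjm : G.jmap x y z s.state j = j := by
      unfold jmap; split_ifs
      · rfl
      · rw [Equiv.swap_apply_of_ne_of_ne hjx hjy]
    rw [hjm] at hj₂ ht₂ ⊢
    have eov : (G.braidMove x y z).overPos j = G.overPos j := G.overPos_braidMove_of_ne hjx hjy hjz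
    obtain ⟨h1, h2, -, -⟩ := G.not_inT_of_chordOf_ne ha hb hc (p := G.overPos j)
      (by rw [chordOf_overPos]; exact hjx) (by rw [chordOf_overPos]; exact hjy) (by rw [chordOf_overPos]; exact hjz)
    exact G.incidence_transport hR tR hj ht hj₂ ht₂ hRs hRt hLs hLt hEs hEt hEs₂ hEt₂ h2 h1
      (.refl _) (.refl _) (.refl _) (.refl _) (by rw [eov]; exact .refl _) (by rw [eov]; exact .refl _)
      (by rw [eov]; exact .refl _) (by rw [eov]; exact .refl _)

/-- **The gauge of the third move on the rests**: the Koszul potential of `(x y)` in the layer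
`z = 0`, the constant `-1` in the layer `z = 1`. [cite: Khovanov2000, §5.4] -/
def gauge (x y z : Fin G.n) (σ : G.State) : ℤ := if σ z = true then -1 else koszulXY x y σ

/-- The gauge is a sign. [folklore] -/
theorem gauge_mul_self (σ : G.State) : G.gauge x y z σ * G.gauge x y z σ = 1 := by
  unfold gauge; split_ifs
  · norm_num
  · exact koszulXY_mul_self x y σ

include hxz ha hb hc hx hy hz in
/-- **The internal entries of the rests correspond up to the gauge**: for rest states `s → t` of
`G` (a flip at `j ≠ z`), `⟨d (toG' s), toG' t⟩ = gauge s · gauge t · ⟨d s, t⟩`.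
[cite: Khovanov2000, §5.4] -/
theorem incidence_toG'_eq_gauge {R : Type} [CommRing R] (hR tR : R) (s t : G.EnhancedState)
    (hs : ¬ (s.state z = true ∧ (s.state x = false → s.state y = false)))
    (ht' : ¬ (t.state z = true ∧ (t.state x = false → t.state y = false)))
    {j : Fin G.n} (hjz : j ≠ z) (hj : s.state j = false) (ht : t.state = Function.update s.state j true) :
    (G.braidMove x y z).incidence R hR tR (G.toG' hxz ha hb hc hx hy hz s hs) (G.toG' hxz ha hb hc hx hy hz t ht') =
      (G.gauge x y z s.state : R) * (G.gauge x y z t.state : R) * G.incidence R hR tR s t := by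
  have key := G.incidence_toG' hxz ha hb hc hx hy hz hR tR s t hs ht' hjz hj ht
  have hsq := Transfer.edgeSign_mul_self (R := R) s.state j
  have htz : t.state z = s.state z := by rw [ht, Function.update_of_ne hjz.symm]
  unfold gauge; rw [htz]
  by_cases hsz : s.state z = true
  · rw [if_pos hsz, if_pos hsz]
    unfold jmap at key; rw [if_pos hsz, G.swapSt_of_z hsz] at key
    push_cast
    linear_combination (edgeSign s.state j : R) * key + (G.incidence R hR tR s t - (G.braidMove x y z).incidence R hR tR
      (G.toG' hxz ha hb hc hx hy hz s hs) (G.toG' hxz ha hb hc hx hy hz t ht')) * hsq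
  · rw [if_neg hsz, if_neg hsz]
    unfold jmap at key; rw [if_neg hsz, G.swapSt_of_not_z hsz, edgeSign_comp_swap (G.x_ne_y ha) s.state j hj, ← ht] at key
    push_cast at key
    linear_combination (edgeSign s.state j : R) * key +
      ((koszulXY x y s.state : R) * (koszulXY x y t.state : R) * G.incidence R hR tR s t -
        (G.braidMove x y z).incidence R hR tR (G.toG' hxz ha hb hc hx hy hz s hs) (G.toG' hxz ha hb hc hx hy hz t ht')) * hsq

include hxz hc in
/-- **No other internal entries**: if `t` is not a single flip of `s`, neither is `toG' t` of
`toG' s`, for rest states in the same layer. [folklore] -/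
theorem not_flip_toG' (s t : G.EnhancedState) (hs) (ht') (hzz : s.state z = t.state z)
    (h : ¬ ∃ j, s.state j = false ∧ t.state = Function.update s.state j true) :
    ¬ ∃ j, (G.toG' hxz ha hb hc hx hy hz s hs).state j = false ∧
      (G.toG' hxz ha hb hc hx hy hz t ht').state = Function.update (G.toG' hxz ha hb hc hx hy hz s hs).state j true := by
  rintro ⟨j, hj, hjt⟩
  rw [toG'_state, toG'_state] at hjt; rw [toG'_state] at hj
  apply h
  by_cases hsz : s.state z = true
  · rw [G.swapSt_of_z hsz, G.swapSt_of_z (hzz ▸ hsz)] at hjt; rw [G.swapSt_of_z hsz] at hj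
    exact ⟨j, hj, hjt⟩
  · have htz : ¬ t.state z = true := by rwa [← hzz]
    rw [G.swapSt_of_not_z hsz, G.swapSt_of_not_z htz] at hjt; rw [G.swapSt_of_not_z hsz] at hj
    refine ⟨Equiv.swap x y j, hj, ?_⟩
    funext i
    have h1 := congrFun hjt (Equiv.swap x y i)
    simp only [comp_apply, Equiv.swap_apply_self, Function.update_apply] at h1
    rw [h1, Function.update_apply]
    split_ifs with h₁ h₂ h₂
    · rfl
    · exact (h₂ (by rw [← h₁, Equiv.swap_apply_self])).elim
    · exact (h₁ (by rw [h₂, Equiv.swap_apply_self])).elim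
    · rfl

end Internal

end GaussDiagram

end Literature.Topology.FourManifolds
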